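import Summits.QuantumFields.YangMills.Theorems.ColdStartUniversalityShenZhuZhuTalagrandWindowsSU2
import Summits.QuantumFields.YangMills.Theorems.ColdStartUniversalityOptimalTransportCouplingCompactness
import Summits.QuantumFields.YangMills.Theorems.ColdStartUniversalityOptimalTransportCouplingGluing
import HarnessLib

/-!
# TALAGRAND'S INEQUALITY FOR THE INFINITE-VOLUME LIMIT POINTS IN THE `ρ_∞` FORM: ONE coupling `P` of `ν` and `μ` on `SU(2)^(E⁺(ℤ³))` with
# `∫ ρ_B² dP ≤ (2/(1−12|β'|))·KL(ν‖μ)` for EVERY finite window `B` (hence `∫ ρ_∞² dP ≤ (2/(1−12|β'|))·KL(ν‖μ)` by monotone convergence)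

Seat `ym-line-csu-p1` (g43), route `ColdStartUniversality` of `Summits/QuantumFields/YangMills`, helper file (`--supports stmt-QuantumFields-24809`; memo-g42 §3
item 3, final form).  Assembly of `limitPoint_window_talagrand_of_klDiv` (window transport bound with the full entropy), the gluing lemma
`exists_isCoupling_lift_of_map` (an `ε`-optimal window coupling lifts to a coupling of `ν, μ` with the same window cost) and the compactness of couplings
(`exists_isCoupling_forall_integral_le`, here with vanishing slack): enumerate the windows, couple optimally for growing unions, pass to a weak cluster point.
* ★ `exists_isCoupling_forall_integral_le_of_slack` — GENERIC: the compactness lemma with slack `K + δ_n`, `δ_n → 0`;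
* ★★★★ **`limitPoint_talagrand_rhoInfty`** — for `μ ∈ infiniteVolumeLimitPoints (fundamentalRep (Fin 2)) β'`, `|β'| < 1/12`, and every probability `ν` with
  `KL(ν‖μ) < ∞`: a coupling `P` of `ν, μ` with `∫ Σ_(ẽ∈B) ρ(x_ẽ,y_ẽ)² dP(x,y) ≤ (2/(1−12|β'|))·KL(ν‖μ)` for all finite `B ⊆ E⁺(ℤ³)`.
THEOREMS ONLY, no definition, no sorry.  HONEST FRAMING: fixed lattice, `|β'| < 1/12`; a statement about infinite-volume limit points of the torus states;
nothing about the continuum; no crux, rung or summit statement is proved; the Yang–Mills mass gap is NOT proved.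
-/

set_option autoImplicit false

noncomputable section

namespace Summit.QuantumFields.YangMills.Theorems.ColdStartUniversality

open MeasureTheory ProbabilityTheory Filter Topology Set Finset BoundedContinuousFunction
open scoped BigOperators NNReal ENNReal
open Literature.MathematicalPhysics.QuantumFieldTheory
open Literature.MathematicalPhysics.QuantumLattice (fundamentalRep fundamentalLatticeRep continuous_fundamentalRep fundamentalRep_apply fundamentalLatticeRep_N
  IsCylinder infiniteVolumeLimitPoints IsInfiniteVolumeLimitAlong toTorusObservable)
open InformationTheory (klDiv)

/-! ## §1. Compactness of couplings with vanishing slack -/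

/-- ★ **Couplings with countably many closed integral constraints, up to a vanishing slack.**  As `exists_isCoupling_forall_integral_le`, but the `n`-th coupling
only satisfies `∫ c_m dπ_n ≤ K + δ_n` (`m ≤ n`) with `δ_n → 0`. [folklore] -/
theorem exists_isCoupling_forall_integral_le_of_slack {X : Type*} [TopologicalSpace X] [CompactSpace X] [T2Space X] [SecondCountableTopology X]
    [MeasurableSpace X] [BorelSpace X]
    (ν μ : Measure X) [IsProbabilityMeasure ν] [IsProbabilityMeasure μ]
    (c : ℕ → C(X × X, ℝ)) (K : ℝ) {δ : ℕ → ℝ} (hδ : Tendsto δ atTop (𝓝 0))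
    (h : ∀ n, ∃ π : Measure (X × X), Literature.Geometry.Riemannian.IsCoupling ν μ π ∧ ∀ m ≤ n, ∫ z, c m z ∂π ≤ K + δ n) :
    ∃ π : Measure (X × X), Literature.Geometry.Riemannian.IsCoupling ν μ π ∧ ∀ m, ∫ z, c m z ∂π ≤ K := by
  classical
  letI : MetricSpace X := TopologicalSpace.metrizableSpaceMetric X
  choose π hπ hle using h
  haveI : ∀ n, IsProbabilityMeasure (π n) := fun n => (hπ n).1
  let P : ℕ → ProbabilityMeasure (X × X) := fun n => ⟨π n, inferInstance⟩
  obtain ⟨P₀, -, hP₀⟩ := (isCompact_univ (X := ProbabilityMeasure (X × X))).exists_clusterPt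
    (f := Filter.map P atTop) (le_principal_iff.2 univ_mem)
  have hclosed : ∀ (F : Set (ProbabilityMeasure (X × X))), IsClosed F → ∀ m : ℕ, (∀ n, m ≤ n → P n ∈ F) → P₀ ∈ F := by
    intro F hF m hmem
    have h1 : Filter.map P atTop ≤ 𝓟 (P '' Set.Ici m) := Filter.le_principal_iff.2 (Filter.image_mem_map (Filter.mem_atTop m))
    have h2 : P₀ ∈ closure (P '' Set.Ici m) := mem_closure_iff_clusterPt.2 (hP₀.mono h1)
    refine hF.closure_subset_iff.2 ?_ h2
    rintro _ ⟨n, hn, rfl⟩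
    exact hmem n hn
  refine ⟨(P₀ : Measure (X × X)), ⟨inferInstance, ?_, ?_⟩, fun m => ?_⟩
  · refine ext_of_forall_lintegral_eq_of_IsFiniteMeasure fun f => ?_
    have hF : IsClosed {Q : ProbabilityMeasure (X × X) | ∫⁻ z, f z.1 ∂(Q : Measure (X × X)) = ∫⁻ x, f x ∂ν} :=
      isClosed_eq (ProbabilityMeasure.continuous_lintegral_boundedContinuousFunction (f.compContinuous ⟨Prod.fst, continuous_fst⟩)) continuous_const
    have hmem := hclosed _ hF 0 fun n _ => by
      show ∫⁻ z, f z.1 ∂(π n) = ∫⁻ x, f x ∂ν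
      rw [← (hπ n).2.1, Measure.fst, lintegral_map f.continuous.measurable.coe_nnreal_ennreal measurable_fst]
    rw [Measure.fst, lintegral_map f.continuous.measurable.coe_nnreal_ennreal measurable_fst]
    exact hmem
  · refine ext_of_forall_lintegral_eq_of_IsFiniteMeasure fun f => ?_
    have hF : IsClosed {Q : ProbabilityMeasure (X × X) | ∫⁻ z, f z.2 ∂(Q : Measure (X × X)) = ∫⁻ x, f x ∂μ} :=
      isClosed_eq (ProbabilityMeasure.continuous_lintegral_boundedContinuousFunction (f.compContinuous ⟨Prod.snd, continuous_snd⟩)) continuous_const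
    have hmem := hclosed _ hF 0 fun n _ => by
      show ∫⁻ z, f z.2 ∂(π n) = ∫⁻ x, f x ∂μ
      rw [← (hπ n).2.2, Measure.snd, lintegral_map f.continuous.measurable.coe_nnreal_ennreal measurable_snd]
    rw [Measure.snd, lintegral_map f.continuous.measurable.coe_nnreal_ennreal measurable_snd]
    exact hmem
  · refine le_of_forall_pos_le_add fun η hη => ?_
    have hF : IsClosed {Q : ProbabilityMeasure (X × X) | ∫ z, c m z ∂(Q : Measure (X × X)) ≤ K + η} :=
      isClosed_le (ProbabilityMeasure.continuous_integral_continuousMap (c m)) continuous_const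
    obtain ⟨N, hN⟩ := (Metric.tendsto_atTop.1 hδ) η hη
    refine hclosed _ hF (max m N) fun n hn => ?_
    have hmn : m ≤ n := le_trans (le_max_left _ _) hn
    have hNn : N ≤ n := le_trans (le_max_right _ _) hn
    have hδn : δ n < η := by have := hN n hNn; rw [Real.dist_eq, sub_zero] at this; exact (abs_lt.1 this).2
    show ∫ z, c m z ∂(π n) ≤ K + η
    exact (hle n m hmn).trans (by linarith)

/-! ## §2. The `ρ_∞` form of Talagrand's inequality for infinite-volume limit points -/

/-- The window cost `z ↦ Σ_(ẽ∈B) ρ(z.1 ẽ, z.2 ẽ)²` as a continuous function on `SU(2)^(E⁺(ℤ³)) × SU(2)^(E⁺(ℤ³))`. [folklore] -/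
theorem continuous_windowCost (B : Finset (Literature.MathematicalPhysics.QuantumLattice.ZdEdge 3)) :
    Continuous fun z : (Literature.MathematicalPhysics.QuantumLattice.LGConfig 3 (Matrix.specialUnitaryGroup (Fin 2) ℂ)) × (Literature.MathematicalPhysics.QuantumLattice.LGConfig 3 (Matrix.specialUnitaryGroup (Fin 2) ℂ)) => (∑ et ∈ B, (fundamentalLatticeRep 2).riemannDist (z.1 et) (z.2 et) ^ 2) := by
  refine continuous_finsetSum _ fun et _ => ?_
  have he : Continuous fun p : (Literature.MathematicalPhysics.QuantumLattice.LGConfig 3 (Matrix.specialUnitaryGroup (Fin 2) ℂ)) × (Literature.MathematicalPhysics.QuantumLattice.LGConfig 3 (Matrix.specialUnitaryGroup (Fin 2) ℂ)) => ((p.1 et, p.2 et) : (Matrix.specialUnitaryGroup (Fin 2) ℂ) × (Matrix.specialUnitaryGroup (Fin 2) ℂ)) :=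
    ((continuous_apply et).comp continuous_fst).prodMk ((continuous_apply et).comp continuous_snd)
  exact (continuous_riemannDist_two.comp he).pow 2

/-- ★★★★ **Talagrand's `T₂(1/(1−12|β'|))` for infinite-volume limit points, `ρ_∞` form (one coupling for all windows).**  Let `|β'| < 1/12`, `μ` an
infinite-volume limit point of the torus Wilson states of three-dimensional `SU(2)` lattice Yang–Mills at coupling `β'`, and `ν` a probability measure on
`SU(2)^(E⁺(ℤ³))` with `KL(ν‖μ) < ∞`.  Then there is a coupling `P` of `ν` and `μ` with
`∫ Σ_(ẽ∈B) ρ(x_ẽ, y_ẽ)² dP(x,y) ≤ (2/(1−12|β'|))·KL(ν‖μ)` for EVERY finite `B ⊆ E⁺(ℤ³)` — i.e. `W₂^(ρ_∞)(ν,μ)² ≤ (2/(1−12|β'|))·KL(ν‖μ)` for the extended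
metric `ρ_∞² = Σ_ẽ ρ_ẽ²` (monotone convergence in `B`). [cite: BakryGentilLedoux2014, Thm 9.6.1] [cite: ShenZhuZhuCMP2023, Theorem 1.4] -/
theorem limitPoint_talagrand_rhoInfty {β' : ℝ} (hβ : |β'| < 1 / 12) {μ : Measure (Literature.MathematicalPhysics.QuantumLattice.LGConfig 3 (Matrix.specialUnitaryGroup (Fin 2) ℂ))}
    (hμ : μ ∈ infiniteVolumeLimitPoints (d := 3) (fundamentalRep (Fin 2)) β')
    (ν : Measure (Literature.MathematicalPhysics.QuantumLattice.LGConfig 3 (Matrix.specialUnitaryGroup (Fin 2) ℂ))) [IsProbabilityMeasure ν] (hfin : klDiv ν μ ≠ ∞) :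
    ∃ P : Measure ((Literature.MathematicalPhysics.QuantumLattice.LGConfig 3 (Matrix.specialUnitaryGroup (Fin 2) ℂ)) × (Literature.MathematicalPhysics.QuantumLattice.LGConfig 3 (Matrix.specialUnitaryGroup (Fin 2) ℂ))), Literature.Geometry.Riemannian.IsCoupling ν μ P ∧
      ∀ B : Finset (Literature.MathematicalPhysics.QuantumLattice.ZdEdge 3), ∫ z, (∑ et ∈ B, (fundamentalLatticeRep 2).riemannDist (z.1 et) (z.2 et) ^ 2) ∂P ≤ 2 * (1 / (1 - 12 * |β'|)) * (klDiv ν μ).toReal := by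
  classical
  haveI := secondCountableTopology_su2
  obtain ⟨Ls, hLs, hprob, hlim⟩ := hμ
  haveI := hprob
  have hμ' : μ ∈ infiniteVolumeLimitPoints (d := 3) (fundamentalRep (Fin 2)) β' := ⟨Ls, hLs, hprob, hlim⟩
  have h12 : 0 < 1 - 12 * |β'| := by linarith
  obtain ⟨K, hKdef⟩ : ∃ K : ℝ, K = 2 * (1 / (1 - 12 * |β'|)) * (klDiv ν μ).toReal := ⟨_, rfl⟩
  have hK0 : 0 ≤ K := by rw [hKdef]; positivity
  rw [← hKdef]
  -- enumerate the windows
  obtain ⟨e, he⟩ := exists_surjective_nat (Finset (Literature.MathematicalPhysics.QuantumLattice.ZdEdge 3))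
  -- the costs
  let c : ℕ → C((Literature.MathematicalPhysics.QuantumLattice.LGConfig 3 (Matrix.specialUnitaryGroup (Fin 2) ℂ)) × (Literature.MathematicalPhysics.QuantumLattice.LGConfig 3 (Matrix.specialUnitaryGroup (Fin 2) ℂ)), ℝ) := fun m => ⟨fun z => (∑ et ∈ e m, (fundamentalLatticeRep 2).riemannDist (z.1 et) (z.2 et) ^ 2), continuous_windowCost (e m)⟩
  have hcnn : ∀ m z, 0 ≤ c m z := fun m z => Finset.sum_nonneg fun _ _ => sq_nonneg _
  -- for each `n`: a coupling good for the union of the first `n+1` windows, with slack `1/(n+1)`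
  have hstep : ∀ n : ℕ, ∃ π : Measure ((Literature.MathematicalPhysics.QuantumLattice.LGConfig 3 (Matrix.specialUnitaryGroup (Fin 2) ℂ)) × (Literature.MathematicalPhysics.QuantumLattice.LGConfig 3 (Matrix.specialUnitaryGroup (Fin 2) ℂ))), Literature.Geometry.Riemannian.IsCoupling ν μ π ∧
      ∀ m ≤ n, ∫ z, c m z ∂π ≤ K + 1 / ((n : ℝ) + 1) := by
    intro n
    obtain ⟨B, hBdef⟩ : ∃ B : Finset (Literature.MathematicalPhysics.QuantumLattice.ZdEdge 3), B = (Finset.range (n + 1)).sup e := ⟨_, rfl⟩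
    have hsub : ∀ m ≤ n, e m ⊆ B := fun m hm => by
      rw [hBdef]; exact Finset.le_sup (f := e) (Finset.mem_range.2 (Nat.lt_succ_of_le hm))
    have hδ : 0 < 1 / ((n : ℝ) + 1) := by positivity
    -- an `ε`-optimal window coupling for `B`
    have hW := limitPoint_window_talagrand_of_klDiv hβ hμ' ν hfin B
    rw [← hKdef] at hW
    have hlt : szzWassersteinSq (fun u v : (↥B → Matrix.specialUnitaryGroup (Fin 2) ℂ) => (∑ i, (fundamentalLatticeRep 2).riemannDist (u i) (v i) ^ 2)) (ν.map (fun (x : Literature.MathematicalPhysics.QuantumLattice.LGConfig 3 (Matrix.specialUnitaryGroup (Fin 2) ℂ)) (b : ↥B) => x b.1)) (μ.map (fun (x : Literature.MathematicalPhysics.QuantumLattice.LGConfig 3 (Matrix.specialUnitaryGroup (Fin 2) ℂ)) (b : ↥B) => x b.1)) <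
        ENNReal.ofReal (K + 1 / ((n : ℝ) + 1)) :=
      lt_of_le_of_lt hW ((ENNReal.ofReal_lt_ofReal_iff (by linarith)).2 (by linarith))
    unfold szzWassersteinSq at hlt
    obtain ⟨q, hq⟩ := iInf_lt_iff.1 hlt
    -- lift it to a coupling of `ν, μ`
    have hr : Measurable (fun (x : Literature.MathematicalPhysics.QuantumLattice.LGConfig 3 (Matrix.specialUnitaryGroup (Fin 2) ℂ)) (b : ↥B) => x b.1) := measurable_pi_lambda _ fun b => measurable_pi_apply _
    have hcm : Measurable fun w : (↥B → Matrix.specialUnitaryGroup (Fin 2) ℂ) × (↥B → Matrix.specialUnitaryGroup (Fin 2) ℂ) => ENNReal.ofReal (∑ i, (fundamentalLatticeRep 2).riemannDist (w.1 i) (w.2 i) ^ 2) :=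
      ENNReal.measurable_ofReal.comp continuous_suProd_distSq.measurable
    obtain ⟨P, hP, hPeq⟩ := exists_isCoupling_lift_of_map ν μ hr q.2 hcm
    haveI : IsProbabilityMeasure P := hP.1
    refine ⟨P, hP, fun m hm => ?_⟩
    -- `∫ c_m dP ≤ ∫ c_B dP = ∫ d_B² dq < K + 1/(n+1)`
    have hsum : ∀ z : (Literature.MathematicalPhysics.QuantumLattice.LGConfig 3 (Matrix.specialUnitaryGroup (Fin 2) ℂ)) × (Literature.MathematicalPhysics.QuantumLattice.LGConfig 3 (Matrix.specialUnitaryGroup (Fin 2) ℂ)), (∑ i : ↥B, (fundamentalLatticeRep 2).riemannDist (z.1 i.1) (z.2 i.1) ^ 2) = (∑ et ∈ B, (fundamentalLatticeRep 2).riemannDist (z.1 et) (z.2 et) ^ 2) := fun z =>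
      Finset.sum_coe_sort B (fun et => (fundamentalLatticeRep 2).riemannDist (z.1 et) (z.2 et) ^ 2)
    have hle1 : ∀ z : (Literature.MathematicalPhysics.QuantumLattice.LGConfig 3 (Matrix.specialUnitaryGroup (Fin 2) ℂ)) × (Literature.MathematicalPhysics.QuantumLattice.LGConfig 3 (Matrix.specialUnitaryGroup (Fin 2) ℂ)), c m z ≤ (∑ et ∈ B, (fundamentalLatticeRep 2).riemannDist (z.1 et) (z.2 et) ^ 2) := fun z =>
      Finset.sum_le_sum_of_subset_of_nonneg (hsub m hm) fun _ _ _ => sq_nonneg _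
    have hBc : Continuous fun z : (Literature.MathematicalPhysics.QuantumLattice.LGConfig 3 (Matrix.specialUnitaryGroup (Fin 2) ℂ)) × (Literature.MathematicalPhysics.QuantumLattice.LGConfig 3 (Matrix.specialUnitaryGroup (Fin 2) ℂ)) => (∑ et ∈ B, (fundamentalLatticeRep 2).riemannDist (z.1 et) (z.2 et) ^ 2) := continuous_windowCost B
    have hBi : Integrable (fun z : (Literature.MathematicalPhysics.QuantumLattice.LGConfig 3 (Matrix.specialUnitaryGroup (Fin 2) ℂ)) × (Literature.MathematicalPhysics.QuantumLattice.LGConfig 3 (Matrix.specialUnitaryGroup (Fin 2) ℂ)) => (∑ et ∈ B, (fundamentalLatticeRep 2).riemannDist (z.1 et) (z.2 et) ^ 2)) P := hBc.integrable_of_hasCompactSupport (HasCompactSupport.of_compactSpace _)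
    have hci : Integrable (fun z => c m z) P := (c m).continuous.integrable_of_hasCompactSupport (HasCompactSupport.of_compactSpace _)
    have hlin : ∫⁻ z, ENNReal.ofReal (∑ et ∈ B, (fundamentalLatticeRep 2).riemannDist (z.1 et) (z.2 et) ^ 2) ∂P < ENNReal.ofReal (K + 1 / ((n : ℝ) + 1)) := by
      have heq : ∫⁻ z, ENNReal.ofReal (∑ et ∈ B, (fundamentalLatticeRep 2).riemannDist (z.1 et) (z.2 et) ^ 2) ∂P = ∫⁻ w : (↥B → Matrix.specialUnitaryGroup (Fin 2) ℂ) × (↥B → Matrix.specialUnitaryGroup (Fin 2) ℂ), ENNReal.ofReal (∑ i, (fundamentalLatticeRep 2).riemannDist (w.1 i) (w.2 i) ^ 2) ∂(q : Measure ((↥B → Matrix.specialUnitaryGroup (Fin 2) ℂ) × (↥B → Matrix.specialUnitaryGroup (Fin 2) ℂ))) := by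
        rw [← hPeq]
        exact lintegral_congr_ae (ae_of_all _ fun z => by dsimp only; rw [← hsum z])
      rw [heq]; exact hq
    have hintB : ∫ z, (∑ et ∈ B, (fundamentalLatticeRep 2).riemannDist (z.1 et) (z.2 et) ^ 2) ∂P ≤ K + 1 / ((n : ℝ) + 1) := by
      rw [integral_eq_lintegral_of_nonneg_ae (ae_of_all _ fun z => Finset.sum_nonneg fun _ _ => sq_nonneg _) hBc.aestronglyMeasurable]
      exact ENNReal.toReal_le_of_le_ofReal (by linarith) hlin.le
    exact (integral_mono hci hBi hle1).trans hintB
  -- compactness with vanishing slack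
  have hδ : Tendsto (fun n : ℕ => 1 / ((n : ℝ) + 1)) atTop (𝓝 0) := tendsto_one_div_add_atTop_nhds_zero_nat
  obtain ⟨P, hP, hall⟩ := exists_isCoupling_forall_integral_le_of_slack ν μ c K hδ hstep
  refine ⟨P, hP, fun B => ?_⟩
  obtain ⟨m, rfl⟩ := he B
  exact hall m

end Summit.QuantumFields.YangMills.Theorems.ColdStartUniversality
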